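/-
Copyright (c) 2026 the pub-hodgecm-mathlib formalisation cell (harness21).  Prover seat hodgecm-mathlib-K2E5-p16 (g6), Track B «K2-LIT»,
#184♮ = hLiu418 = `stmt-HodgeConjecture-24832`; #42S organ S2 «ARCH SPAN BY K-TYPE PATHS» (RULING «M-158f», DESIGN-S2 41bd43fff4457fcc §3 (ii),
BATCH #7 (b)(c)), file S2-P PART B `K2LiuU22CompactPicturePOperators`: the right Lie derivative of a Siegel section along a curve, read in the
compact picture — multiplier `(m∕2 − k)·τ + (m∕2)·τ̄` (`m = k − 2s − l`; ref1's `p·τ_hol + q·τ_antihol`, `κ = −k`) plus the compact-picture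
derivative along the Shilov coordinate, whose velocity is `D⁻⁻¹(W⁺ − W⁻·v₀)`.  THEOREMS ONLY (no `def`, no `instance`, no notation, no
named-fact hypothesis, no `sorry`; generic rank `l`).
-/
import Summits.HodgeConjecture.HodgeConjecture.Theorems.K2LiuU22ShilovCoordinate                    -- S2-P part A (this seat)
import Summits.HodgeConjecture.HodgeConjecture.Theorems.K2LiuArchIntertwiningLieDerivativePrelims     -- ★ (A) prelims: master formula at `t₀`
import HarnessLib

/-!
# Crux `HLiu418`, organ S2, S2-P part B: the Lie derivative of a Siegel section in the compact picture

Cell `hodgecm-mathlib`, crux item hLiu418 = `stmt-HodgeConjecture-24832` (helper lane `--supports`, count-neutral).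

Part A (★ `K2LiuU22ShilovCoordinate.apply_eq_mul_apply_kU`): for `A ∈ I_w(s, χ)` and `h ∈ U(J)`,
`A h = χ(det (D⁻⁻¹)ᴴ)·‖det (D⁻⁻¹)ᴴ‖^{2s+l} · A(k_{v(h)})`, `D^± = denom h (±i1)`, `v(h) = D⁻⁻¹D⁺ ∈ U(l)`.  This file differentiates it:
* §0 `denom (X · M) (i1) = denom X (−i1)` for the REFLECTION `M = diag(−1, 1)`, and for `χ = χ_k(z) = (z̄∕‖z‖)^k` the multiplier IS
  `archScalarSection k s (h · M)` (`multiplier_eq_archScalarSection`) — so ★ (A)'s master formula applies verbatim;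
* §1 `hasDerivAt_multiplier`: along an entrywise-C¹ curve `h_t ∈ U(J)` with velocity `H` at `0`,
  `d∕dt|₀ archScalarSection k s (h_t M) = archScalarSection k s (h₀M) · ((m∕2 − k)·τ + (m∕2)·conj τ)`, `τ = tr(D⁻⁻¹ · denom H (−i1))`, `m = k − 2s − l`
  (ref1 PREP-S2 §1: `−(p·τ + q·τ̄)` with `p = s+1+κ∕2`, `q = s+1−κ∕2` at `l = 2`, `κ = −k`);
* §2 THE LIE DERIVATIVE (general `χ`: `hasDerivAt_section_comp_curve`; `χ_k`: `hasDerivAt_section_comp_curve_chiK`):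
  `d∕dt|₀ A(h_t) = μ′·A(k_{v₀}) + μ₀·G′` where `G′ = d∕dt|₀ A(k_{v(h_t)})` is the derivative of the COMPACT PICTURE along the Shilov coordinate;
* §3 THE SHILOV VELOCITY (`shilov_velocity_eq`): if `v(h_t)` is entrywise differentiable at `0` with velocity `V` then
  `D⁻·V = W⁺ − W⁻·v₀`, `W^± = denom H (±i1)` — i.e. `V = D⁻⁻¹(W⁺ − W⁻ v₀)`; at `h₀ = k_u`: `D⁻ = 1`, `v₀ = u`, `V = W⁺ − W⁻ u` (the quadratic
  vector field of ref1's `P_β ∕ M_γ`, DESIGN-S2 §3 (ii)).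
Part C instantiates `h_t = k_u · exp(tX)` for the root types and matches S2-K's letters (★ `K2LiuU22CompactPictureDefs.pOp ∕ mOp`).
References: [Knapp1986, Ch. VII §1, Ch. VIII §3]; [Shimura1997, §16.4]; [LeeZhu1998, p. 5032]; K2Liu-ref1 PREP-S2 §1.
HONEST LABEL: HC_CM is proved only modulo the 7 printed citations (2 remaining named inputs: hLiu418 = stmt-HodgeConjecture-24832,
h413 = stmt-HodgeConjecture-24833) until rung 0 closes; count-neutral helper, closes no socket.
-/

set_option autoImplicit false
set_option linter.dupNamespace false

noncomputable section

open Complex Matrix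
open scoped ComplexConjugate

namespace Summit.HodgeConjecture.HodgeConjecture.Cruxes.HLiu418.K2LiuU22CompactPicturePOperators

open Literature.NumberTheory.ModularForms.SiegelUpperHalfSpace (num denom moeb num_def denom_def moeb_def num_fromBlocks denom_fromBlocks
  denom_mul num_mul)
open Summit.HodgeConjecture.HodgeConjecture.Cruxes.HLiu418.K2LiuHermitianTubeCocycle
open Summit.HodgeConjecture.HodgeConjecture.Cruxes.HLiu418.K2LiuHermitianTubeDescend (isUnit_det_of_mem_UJ)
open Summit.HodgeConjecture.HodgeConjecture.Cruxes.HLiu418.K2LiuArchInducedTubeDefs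
open Summit.HodgeConjecture.HodgeConjecture.Cruxes.HLiu418.K2LiuU22ShilovCoordinate
open Summit.HodgeConjecture.HodgeConjecture.Cruxes.HLiu418.K2LiuArchIntertwiningLieDerivativePrelims (hasDerivAt_archScalarSection_mul_curve_at)

variable {l : Type*} [Fintype l] [DecidableEq l]

/-! ## §0  The reflection `M = diag(−1, 1)` and the multiplier as a scalar section -/

/-- `denom (X · diag(−1,1)) (i1) = denom X (−i1)` for every `X`. [folklore] -/
theorem denom_mul_reflect (X : Matrix (l ⊕ l) (l ⊕ l) ℂ) :
    denom (X * fromBlocks (-1) 0 0 1) (I • (1 : Matrix l l ℂ)) = denom X (-(I • (1 : Matrix l l ℂ))) := by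
  rw [denom_mul, num_fromBlocks, denom_fromBlocks, denom_def, Matrix.zero_mul, zero_add, add_zero, Matrix.mul_one, Matrix.neg_mul,
    Matrix.one_mul]

/-- `det diag(−1, 1) ≠ 0`. [folklore] -/
theorem isUnit_det_reflect : IsUnit (fromBlocks (-1) 0 0 1 : Matrix (l ⊕ l) (l ⊕ l) ℂ).det := by
  rw [det_fromBlocks_zero₂₁, det_one, mul_one, det_neg, det_one, mul_one]
  exact (isUnit_one.neg.pow _)

/-- **THE MULTIPLIER OF PART A IS A SCALAR SECTION AT THE REFLECTED POINT**: for `χ_k(z) = (z̄∕‖z‖)^k` and `det D⁻ ≠ 0`,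
`χ_k(det (D⁻⁻¹)ᴴ) · ‖det (D⁻⁻¹)ᴴ‖^{2s+l} = archScalarSection k s (h · diag(−1,1))` (`= (det D⁻)^{−k} ‖det D⁻‖^{k−2s−l}`). [Shimura1997, §16.4] -/
theorem multiplier_eq_archScalarSection (k : ℤ) (s : ℂ) {h : Matrix (l ⊕ l) (l ⊕ l) ℂ}
    (hD : IsUnit (denom h (-(I • (1 : Matrix l l ℂ)))).det) :
    (fun z : ℂ => (conj z / ((‖z‖ : ℝ) : ℂ)) ^ k) ((denom h (-(I • (1 : Matrix l l ℂ))))⁻¹)ᴴ.det *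
        (((‖((denom h (-(I • (1 : Matrix l l ℂ))))⁻¹)ᴴ.det‖ : ℝ) : ℂ) ^ (2 * s + (Fintype.card l : ℂ))) =
      archScalarSection k s (h * fromBlocks (-1) 0 0 1) := by
  set w : ℂ := (denom h (-(I • (1 : Matrix l l ℂ)))).det with hw
  have hw0 : w ≠ 0 := hD.ne_zero
  have hz : ((denom h (-(I • (1 : Matrix l l ℂ))))⁻¹)ᴴ.det = conj (w⁻¹) := by
    rw [det_conjTranspose, det_nonsing_inv, Ring.inverse_eq_inv', Complex.star_def]
  rw [archScalarSection_apply, denom_mul_reflect, ← hw, hz]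
  simp only [Complex.conj_conj, Complex.norm_conj, norm_inv, Complex.ofReal_inv]
  have hn0 : ((‖w‖ : ℝ) : ℂ) ≠ 0 := by exact_mod_cast (norm_ne_zero_iff.2 hw0)
  have harg : ((‖w‖ : ℝ) : ℂ).arg ≠ Real.pi := by
    rw [Complex.arg_ofReal_of_nonneg (norm_nonneg _)]; exact Real.pi_pos.ne
  rw [div_inv_eq_mul, mul_zpow, _root_.inv_zpow, ← _root_.zpow_neg, Complex.inv_cpow _ _ harg, ← Complex.cpow_neg,
    ← Complex.cpow_intCast ((‖w‖ : ℝ) : ℂ) k, mul_assoc, ← Complex.cpow_add _ _ hn0]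
  congr 2
  ring

/-! ## §1  The derivative of the multiplier along a curve -/

omit [DecidableEq l] in
/-- Entries of `t ↦ X_t · C` are differentiable with derivative `(X′ · C)_{ij}` (constant right factor). [folklore] -/
theorem hasDerivAt_mul_const_entry {X X' : ℝ → Matrix (l ⊕ l) (l ⊕ l) ℂ} (C : Matrix (l ⊕ l) (l ⊕ l) ℂ)
    (hX : ∀ t i j, HasDerivAt (fun t => X t i j) (X' t i j) t) (t : ℝ) (i j : l ⊕ l) :
    HasDerivAt (fun t => (X t * C) i j) ((X' t * C) i j) t := by
  have hfun : (fun t => (X t * C) i j) = fun t => ∑ q, X t i q * C q j := by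
    funext u; rw [Matrix.mul_apply]
  rw [hfun, Matrix.mul_apply]
  exact HasDerivAt.fun_sum fun q _ => (hX t i q).mul_const (C q j)

/-- **THE MULTIPLIER'S DERIVATIVE**: along an entrywise differentiable curve `h_t` with `h₀ ∈ U(J)`,
`d∕dt|₀ archScalarSection k s (h_t · diag(−1,1)) = archScalarSection k s (h₀ · diag(−1,1)) · ((m∕2 − k)·τ + (m∕2)·conj τ)`,
`τ = tr((denom h₀ (−i1))⁻¹ · denom h′₀ (−i1))`, `m = k − 2s − l` (★ (A) master formula at the reflected point). [Shimura1997, §16.4; Knapp1986, VII §1] -/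
theorem hasDerivAt_multiplier (k : ℤ) (s : ℂ) {h h' : ℝ → Matrix (l ⊕ l) (l ⊕ l) ℂ}
    (hh0 : (h 0)ᴴ * Matrix.J l ℂ * h 0 = Matrix.J l ℂ) (hH : ∀ t i j, HasDerivAt (fun t => h t i j) (h' t i j) t) :
    HasDerivAt (fun t : ℝ => archScalarSection k s (h t * fromBlocks (-1) 0 0 1))
      (archScalarSection k s (h 0 * fromBlocks (-1) 0 0 1) *
        ((((k : ℂ) - 2 * s - (Fintype.card l : ℂ)) / 2 - k) *
            ((denom (h 0) (-(I • (1 : Matrix l l ℂ))))⁻¹ * denom (h' 0) (-(I • (1 : Matrix l l ℂ)))).trace +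
          ((k : ℂ) - 2 * s - (Fintype.card l : ℂ)) / 2 *
            conj ((denom (h 0) (-(I • (1 : Matrix l l ℂ))))⁻¹ * denom (h' 0) (-(I • (1 : Matrix l l ℂ)))).trace)) 0 := by
  have hγ := hasDerivAt_mul_const_entry (fromBlocks (-1) 0 0 1 : Matrix (l ⊕ l) (l ⊕ l) ℂ) hH
  have hγ0 : IsUnit (h 0 * fromBlocks (-1) 0 0 1 : Matrix (l ⊕ l) (l ⊕ l) ℂ).det := by
    rw [det_mul]; exact (isUnit_det_of_mem_UJ hh0).mul isUnit_det_reflect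
  have hx : (denom ((1 : Matrix (l ⊕ l) (l ⊕ l) ℂ) * (h 0 * fromBlocks (-1) 0 0 1)) (I • (1 : Matrix l l ℂ))).det ≠ 0 := by
    rw [Matrix.one_mul, denom_mul_reflect]; exact (isUnit_det_denom_negI hh0).ne_zero
  have hmain := hasDerivAt_archScalarSection_mul_curve_at k s (x := (1 : Matrix (l ⊕ l) (l ⊕ l) ℂ)) (t₀ := 0) hγ hγ0 hx
  simp only [Matrix.one_mul, denom_mul_reflect] at hmain
  exact hmain

/-! ## §2  The Lie derivative of a Siegel section along a curve, read in the compact picture -/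

/-- **THE LIE DERIVATIVE IN THE COMPACT PICTURE (general `χ`)**: if `h_t ∈ U(J)` for all `t`, the multiplier
`μ(t) = χ(det (D⁻_t⁻¹)ᴴ)·‖det (D⁻_t⁻¹)ᴴ‖^{2s+l}` has derivative `μ′` at `0` and the compact picture `t ↦ A(k_{v(h_t)})` has derivative `G′` at `0`,
then `d∕dt|₀ A(h_t) = μ′ · A(k_{v(h₀)}) + μ(0) · G′`. [Knapp1986, VII §1, VIII §3] -/
theorem hasDerivAt_section_comp_curve {χ : ℂ → ℂ} {s : ℂ} {A : Matrix (l ⊕ l) (l ⊕ l) ℂ → ℂ} (hA : IsArchSiegelSection χ s A)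
    {h : ℝ → Matrix (l ⊕ l) (l ⊕ l) ℂ} (hh : ∀ t, (h t)ᴴ * Matrix.J l ℂ * h t = Matrix.J l ℂ) {μ' G' : ℂ}
    (hμ : HasDerivAt (fun t : ℝ => χ ((denom (h t) (-(I • (1 : Matrix l l ℂ))))⁻¹)ᴴ.det *
        (((‖((denom (h t) (-(I • (1 : Matrix l l ℂ))))⁻¹)ᴴ.det‖ : ℝ) : ℂ) ^ (2 * s + (Fintype.card l : ℂ)))) μ' 0)
    (hG : HasDerivAt (fun t : ℝ => A ((2 : ℂ)⁻¹ • fromBlocks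
        (1 + (denom (h t) (-(I • (1 : Matrix l l ℂ))))⁻¹ * denom (h t) (I • (1 : Matrix l l ℂ)))
        (-(I • (1 - (denom (h t) (-(I • (1 : Matrix l l ℂ))))⁻¹ * denom (h t) (I • (1 : Matrix l l ℂ)))))
        (I • (1 - (denom (h t) (-(I • (1 : Matrix l l ℂ))))⁻¹ * denom (h t) (I • (1 : Matrix l l ℂ))))
        (1 + (denom (h t) (-(I • (1 : Matrix l l ℂ))))⁻¹ * denom (h t) (I • (1 : Matrix l l ℂ))))) G' 0) :
    HasDerivAt (fun t : ℝ => A (h t))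
      (μ' * A ((2 : ℂ)⁻¹ • fromBlocks
          (1 + (denom (h 0) (-(I • (1 : Matrix l l ℂ))))⁻¹ * denom (h 0) (I • (1 : Matrix l l ℂ)))
          (-(I • (1 - (denom (h 0) (-(I • (1 : Matrix l l ℂ))))⁻¹ * denom (h 0) (I • (1 : Matrix l l ℂ)))))
          (I • (1 - (denom (h 0) (-(I • (1 : Matrix l l ℂ))))⁻¹ * denom (h 0) (I • (1 : Matrix l l ℂ))))
          (1 + (denom (h 0) (-(I • (1 : Matrix l l ℂ))))⁻¹ * denom (h 0) (I • (1 : Matrix l l ℂ)))) +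
        χ ((denom (h 0) (-(I • (1 : Matrix l l ℂ))))⁻¹)ᴴ.det *
            (((‖((denom (h 0) (-(I • (1 : Matrix l l ℂ))))⁻¹)ᴴ.det‖ : ℝ) : ℂ) ^ (2 * s + (Fintype.card l : ℂ))) * G') 0 := by
  have hfun : (fun t : ℝ => A (h t)) = fun t : ℝ =>
      (χ ((denom (h t) (-(I • (1 : Matrix l l ℂ))))⁻¹)ᴴ.det *
          (((‖((denom (h t) (-(I • (1 : Matrix l l ℂ))))⁻¹)ᴴ.det‖ : ℝ) : ℂ) ^ (2 * s + (Fintype.card l : ℂ)))) *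
        A ((2 : ℂ)⁻¹ • fromBlocks
          (1 + (denom (h t) (-(I • (1 : Matrix l l ℂ))))⁻¹ * denom (h t) (I • (1 : Matrix l l ℂ)))
          (-(I • (1 - (denom (h t) (-(I • (1 : Matrix l l ℂ))))⁻¹ * denom (h t) (I • (1 : Matrix l l ℂ)))))
          (I • (1 - (denom (h t) (-(I • (1 : Matrix l l ℂ))))⁻¹ * denom (h t) (I • (1 : Matrix l l ℂ))))
          (1 + (denom (h t) (-(I • (1 : Matrix l l ℂ))))⁻¹ * denom (h t) (I • (1 : Matrix l l ℂ)))) := by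
    funext t
    exact apply_eq_mul_apply_kU hA (hh t)
  rw [hfun]
  exact hμ.mul hG

/-- **THE LIE DERIVATIVE IN THE COMPACT PICTURE (`χ = χ_k`)**: for `A ∈ I_w(s, χ_k)`, `χ_k(z) = (z̄∕‖z‖)^k`, an entrywise-C¹ curve `h_t ∈ U(J)`
with velocity `h′`, and `G′ = d∕dt|₀ A(k_{v(h_t)})`:
`d∕dt|₀ A(h_t) = f⁰(h₀M)·((m∕2 − k)τ + (m∕2)τ̄)·A(k_{v₀}) + f⁰(h₀M)·G′`, `f⁰ = archScalarSection k s`, `M = diag(−1,1)`,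
`τ = tr((denom h₀ (−i1))⁻¹ denom h′₀ (−i1))`, `m = k − 2s − l`. [Knapp1986, VIII §3; Shimura1997, §16.4; LeeZhu1998, p. 5032] -/
theorem hasDerivAt_section_comp_curve_chiK (k : ℤ) (s : ℂ) {A : Matrix (l ⊕ l) (l ⊕ l) ℂ → ℂ}
    (hA : IsArchSiegelSection (fun z : ℂ => (conj z / ((‖z‖ : ℝ) : ℂ)) ^ k) s A)
    {h h' : ℝ → Matrix (l ⊕ l) (l ⊕ l) ℂ} (hh : ∀ t, (h t)ᴴ * Matrix.J l ℂ * h t = Matrix.J l ℂ)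
    (hH : ∀ t i j, HasDerivAt (fun t => h t i j) (h' t i j) t) {G' : ℂ}
    (hG : HasDerivAt (fun t : ℝ => A ((2 : ℂ)⁻¹ • fromBlocks
        (1 + (denom (h t) (-(I • (1 : Matrix l l ℂ))))⁻¹ * denom (h t) (I • (1 : Matrix l l ℂ)))
        (-(I • (1 - (denom (h t) (-(I • (1 : Matrix l l ℂ))))⁻¹ * denom (h t) (I • (1 : Matrix l l ℂ)))))
        (I • (1 - (denom (h t) (-(I • (1 : Matrix l l ℂ))))⁻¹ * denom (h t) (I • (1 : Matrix l l ℂ))))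
        (1 + (denom (h t) (-(I • (1 : Matrix l l ℂ))))⁻¹ * denom (h t) (I • (1 : Matrix l l ℂ))))) G' 0) :
    HasDerivAt (fun t : ℝ => A (h t))
      (archScalarSection k s (h 0 * fromBlocks (-1) 0 0 1) *
          ((((k : ℂ) - 2 * s - (Fintype.card l : ℂ)) / 2 - k) *
              ((denom (h 0) (-(I • (1 : Matrix l l ℂ))))⁻¹ * denom (h' 0) (-(I • (1 : Matrix l l ℂ)))).trace +
            ((k : ℂ) - 2 * s - (Fintype.card l : ℂ)) / 2 *
              conj ((denom (h 0) (-(I • (1 : Matrix l l ℂ))))⁻¹ * denom (h' 0) (-(I • (1 : Matrix l l ℂ)))).trace) *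
          A ((2 : ℂ)⁻¹ • fromBlocks
            (1 + (denom (h 0) (-(I • (1 : Matrix l l ℂ))))⁻¹ * denom (h 0) (I • (1 : Matrix l l ℂ)))
            (-(I • (1 - (denom (h 0) (-(I • (1 : Matrix l l ℂ))))⁻¹ * denom (h 0) (I • (1 : Matrix l l ℂ)))))
            (I • (1 - (denom (h 0) (-(I • (1 : Matrix l l ℂ))))⁻¹ * denom (h 0) (I • (1 : Matrix l l ℂ))))
            (1 + (denom (h 0) (-(I • (1 : Matrix l l ℂ))))⁻¹ * denom (h 0) (I • (1 : Matrix l l ℂ)))) +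
        archScalarSection k s (h 0 * fromBlocks (-1) 0 0 1) * G') 0 := by
  have hμfun : (fun t : ℝ => (fun z : ℂ => (conj z / ((‖z‖ : ℝ) : ℂ)) ^ k) ((denom (h t) (-(I • (1 : Matrix l l ℂ))))⁻¹)ᴴ.det *
      (((‖((denom (h t) (-(I • (1 : Matrix l l ℂ))))⁻¹)ᴴ.det‖ : ℝ) : ℂ) ^ (2 * s + (Fintype.card l : ℂ)))) =
      fun t : ℝ => archScalarSection k s (h t * fromBlocks (-1) 0 0 1) := by
    funext t
    exact multiplier_eq_archScalarSection k s (isUnit_det_denom_negI (hh t))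
  have hμ := hasDerivAt_multiplier k s (hh 0) hH
  rw [← hμfun] at hμ
  have hmain := hasDerivAt_section_comp_curve hA hh hμ hG
  rw [multiplier_eq_archScalarSection k s (isUnit_det_denom_negI (hh 0))] at hmain
  exact hmain

/-! ## §3  The velocity of the Shilov coordinate -/

omit [DecidableEq l] in
/-- Entries of `t ↦ denom (h_t) Z` are differentiable with derivative `(denom h′ Z)_{ij}` (`denom` is linear in the matrix). [folklore] -/
theorem hasDerivAt_denom_entry {h : ℝ → Matrix (l ⊕ l) (l ⊕ l) ℂ} {H : Matrix (l ⊕ l) (l ⊕ l) ℂ} (Z : Matrix l l ℂ)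
    (hH : ∀ i j, HasDerivAt (fun t => h t i j) (H i j) 0) (i j : l) :
    HasDerivAt (fun t => denom (h t) Z i j) (denom H Z i j) 0 := by
  have hfun : (fun t => denom (h t) Z i j) = fun t => ∑ q, h t (Sum.inr i) (Sum.inl q) * Z q j + h t (Sum.inr i) (Sum.inr j) := by
    funext t; rw [denom_def, Matrix.add_apply, Matrix.mul_apply]; rfl
  rw [hfun, denom_def, Matrix.add_apply, Matrix.mul_apply]
  exact (HasDerivAt.fun_sum fun q _ => (hH _ _).mul_const _).add (hH _ _)

omit [Fintype l] [DecidableEq l] in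
/-- Entries of a product of entrywise differentiable matrix curves: `d(X·Y)_{ij} = (X′·Y₀ + X₀·Y′)_{ij}`. [folklore] -/
theorem hasDerivAt_mul_entry {m : Type*} [Fintype m] {X : ℝ → Matrix l m ℂ} {Y : ℝ → Matrix m l ℂ} {X' : Matrix l m ℂ} {Y' : Matrix m l ℂ}
    (hX : ∀ i q, HasDerivAt (fun t => X t i q) (X' i q) 0) (hY : ∀ q j, HasDerivAt (fun t => Y t q j) (Y' q j) 0) (i j : l) :
    HasDerivAt (fun t => (X t * Y t) i j) ((X' * Y 0 + X 0 * Y') i j) 0 := by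
  have hfun : (fun t => (X t * Y t) i j) = fun t => ∑ q, X t i q * Y t q j := by
    funext t; rw [Matrix.mul_apply]
  rw [hfun, Matrix.add_apply, Matrix.mul_apply, Matrix.mul_apply, ← Finset.sum_add_distrib]
  exact HasDerivAt.fun_sum fun q _ => (hX i q).mul (hY q j)

/-- **THE SHILOV VELOCITY**: if `h_t ∈ U(J)` is entrywise differentiable at `0` with velocity `H` and the Shilov coordinate
`v_t = (denom h_t (−i1))⁻¹ · denom h_t (i1)` is entrywise differentiable at `0` with velocity `V`, then
`denom h₀ (−i1) · V = denom H (i1) − denom H (−i1) · v₀` — i.e. `V = D⁻⁻¹(W⁺ − W⁻ v₀)`; at `h₀ = k_u` (`D⁻ = 1`, `v₀ = u`): `V = W⁺ − W⁻ u`.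
[Knapp1986, VII §1; LeeZhu1998, p. 5032] -/
theorem shilov_velocity_eq {h : ℝ → Matrix (l ⊕ l) (l ⊕ l) ℂ} {H : Matrix (l ⊕ l) (l ⊕ l) ℂ} {V : Matrix l l ℂ}
    (hh : ∀ t, (h t)ᴴ * Matrix.J l ℂ * h t = Matrix.J l ℂ) (hH : ∀ i j, HasDerivAt (fun t => h t i j) (H i j) 0)
    (hV : ∀ i j, HasDerivAt (fun t => ((denom (h t) (-(I • (1 : Matrix l l ℂ))))⁻¹ * denom (h t) (I • (1 : Matrix l l ℂ))) i j) (V i j) 0) :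
    denom (h 0) (-(I • (1 : Matrix l l ℂ))) * V =
      denom H (I • (1 : Matrix l l ℂ)) -
        denom H (-(I • (1 : Matrix l l ℂ))) * ((denom (h 0) (-(I • (1 : Matrix l l ℂ))))⁻¹ * denom (h 0) (I • (1 : Matrix l l ℂ))) := by
  -- differentiate the identity `D⁻_t · v_t = D⁺_t` entrywise and compare derivatives
  have hid : ∀ t, denom (h t) (-(I • (1 : Matrix l l ℂ))) * ((denom (h t) (-(I • (1 : Matrix l l ℂ))))⁻¹ * denom (h t) (I • 1)) =
      denom (h t) (I • (1 : Matrix l l ℂ)) := fun t => by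
    rw [← Matrix.mul_assoc, Matrix.mul_nonsing_inv _ (isUnit_det_denom_negI (hh t)), Matrix.one_mul]
  have hW : ∀ i j, HasDerivAt (fun t => denom (h t) (-(I • (1 : Matrix l l ℂ))) i j) (denom H (-(I • (1 : Matrix l l ℂ))) i j) 0 :=
    hasDerivAt_denom_entry _ hH
  have hE : denom H (-(I • (1 : Matrix l l ℂ))) * ((denom (h 0) (-(I • (1 : Matrix l l ℂ))))⁻¹ * denom (h 0) (I • 1)) +
      denom (h 0) (-(I • (1 : Matrix l l ℂ))) * V = denom H (I • (1 : Matrix l l ℂ)) := by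
    ext i j
    have h1 := hasDerivAt_mul_entry hW hV i j
    have h2 : HasDerivAt (fun t => (denom (h t) (-(I • (1 : Matrix l l ℂ))) * ((denom (h t) (-(I • (1 : Matrix l l ℂ))))⁻¹ * denom (h t) (I • 1))) i j)
        (denom H (I • (1 : Matrix l l ℂ)) i j) 0 := by
      simp only [hid]; exact hasDerivAt_denom_entry _ hH i j
    exact h1.unique h2
  rw [← hE]
  abel

end Summit.HodgeConjecture.HodgeConjecture.Cruxes.HLiu418.K2LiuU22CompactPicturePOperators

end
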